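import Mathlib
import Summits.PneNP.PneNP.Theses.OverlapGapAlgebra
import Literature.Probability.LatticeModels.BinomialEntropy
import Summits.PneNP.PneNP.Theorems.OverlapGapAlgebraNoStableSectionDefs
import Summits.PneNP.PneNP.Theorems.SolvableImpliesStableSection.Negative.FalseAtEtaZero
import Summits.PneNP.PneNP.Theorems.OverlapGapAlgebraSolvableImpliesStableSectionEtaGeOne
import Summits.PneNP.PneNP.Theorems.SolvableImpliesStableSection.Negative.EndpointsFar
import Summits.PneNP.PneNP.Theorems.SolvableImpliesStableSection.Negative.FalseAtEtaZeroSharp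

/-!
# Disproof of `SolvableImpliesStableSection` (stmt-PneNP-2463) — standing disprover's work file

Crux (route OverlapGapAlgebra, rank 3, "instability needs algebra", k-SAT instance):
`∀ k ≥ 3, ∀ α η ν > 0, Solvable k α → Concl k α η ν` (`solvableImpliesStableSection_iff`, by `Iff.rfl`),
where `Solvable k α` = "some `IsPolyTime f` solves `F_k(n, ⌊α n⌋)` with probability `≥ ε` for
infinitely many `n`" and `Concl k α η ν` = "for every `c > 0`, infinitely often some map `g` is
`ν`-valid and `η n`-stable along the whole Bresler–Huang resampling path with probability `≥ e^{-cn}`".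

## Findings (cycle 1, refuter-cdisprove-stmt-PneNP-2463-0, 2026-08-16)

* **No kill.** A refutation needs BOTH an inhabitant of `Solvable k α` (a Lean `TM2ComputableInPolyTime`
  solver with non-vanishing success — no fixed assignment works at any `α > 0`, success `(1-2^{-k})^m → 0`;
  a genuine solver TM is not constructible here) AND an impossibility theorem for all sections `g`
  at the same `(k, α)` for some `(η, ν)`.  In print the solvable regimes (`α < 2^k/k` UC, Chao–Franco;
  `(1-ε)2^k ln k/k`, Coja-Oghlan 2010) and the chaos/OGP regime (`α ≥ 4.911·2^k ln k/k`,
  Bresler–Huang 2021 Thm 2.6 read for all maps = item 2462) are DISJOINT, and the k = 3 numerics on the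
  item (kit j016830, j016952/j017049: displacement/n decreasing in n up to α = 4.2) show no chaos where
  algorithms work.  So the crux is consistent with everything known: it resists because its only
  refutable content ("efficiently solvable ⇒ stably sectionable" strictly between the algorithmic and
  the OGP thresholds) has no candidate unstable algorithm (the XORSAT/Holmgren–Wein pattern needs an
  affine template, absent in k-SAT).
* **Load-bearing analysis (theorems below).**
  - `hα : 0 < α` is decoration: for `α ≤ 0`, `m = 0` and `Concl` holds trivially (`concl_of_nonpos`).
  - `3 ≤ k`: at `k = 0` the hypothesis is unsatisfiable (`not_solvable_zero`), so nothing is owed.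
  - `0 < η`, `0 < ν`: for `η < 0` or `ν < 0` the conclusion is false outright (`concl_false_of_eta_neg`,
    `concl_false_of_nu_neg`) — trivial, recorded for completeness.
  - **`Solvable` is load-bearing (unconditional): `solvableImpliesStableSection_false_without_solvable`.**
    In the unsatisfiable phase the CONCLUSION fails: for `k ≥ 1`, `0 ≤ ν ≤ 1/2`, `c > 0` and
    `log 2 + c < α((1-ν)2^{-k} - h₂(ν))`, NO section is even `ν`-valid at the path's origin except on an
    `e^{-cn}`-small set of paths (`concl_false_of_rate`, first moment over assignments + the counting
    Chernoff bound `ind_card_violCount_le` of the NoStableSection development); witness `k = 3, ν = 1/128,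
    α = 32, c = 1`.  Complements the lead's `solvableImpliesStableSection_hyp_false_of_density_ge`
    (hypothesis false for `α ≥ 2^k`): at large density the crux is vacuously true AND its conclusion
    false, so no proof can establish `Concl` uniformly in `α` — the density must enter through `Solvable`.
  - **`IsPolyTime` is load-bearing (modulo the route's two printed theorems):**
    `solvableImpliesStableSection_false_without_polyTime_of :
      NoStableSection → PositiveSatProbability → ¬ SolvableImpliesStableSectionWithoutPolyTime`
    (crux NOTES B1 as a theorem at crux level: the complexity-free solver `f*` — decode, output a good
    word if one exists — meets the hypothesis minus `IsPolyTime` in the BH window by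
    `PositiveSatProbability`, and `NoStableSection` denies the conclusion there).  Hence any proof must
    use the polynomial-time machine of `f` white-box; every argument black-box in `f` is dead.  (The
    lead's pending `transfer_false_without_polyTime` is the stub-level version, about `stub_transfer`'s
    stronger conclusion; this one is about the crux's own conclusion.)
* **Landed / proposed under `Theorems/SolvableImpliesStableSection/Negative/`** (def-free restatements
  of the theorems of this file): `OriginValidCount.lean` (p109130, ACCEPTED: `card_originValid_le`,
  the first-moment count), `FalseWithoutSolvable.lean` (p109737, ACCEPTED: `concl_false_of_rate`,
  `solvableImpliesStableSection_false_without_solvable`), `FalseWithoutPolyTime.lean` (p112480, review-queued for the new def `fStar`; revision of p111092/p109740: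
  `solvableImpliesStableSection_false_without_polyTime_of`).
* **Targets (line `Sketch`).** `stub_transfer` (stub 7) minus `hsolv` is FALSE:
  `stub_transfer_false_without_hsolv : ¬ StubTransferWithoutHsolv` — at `(3, 32, 1, 1/128)` already
  conditions (i) `ν`-valid on `G` ∧ (ii) `(km)#Gᶜ ≤ A#Inst` are unsatisfiable for large `n`
  (`card_instValid_le`: fewer than half the instances admit that `g Φ` be `ν`-valid ⇒ `3m < 2A`).  So
  SmoothSection is reachable only THROUGH `hsolv`, like the crux's conclusion; the jump condition (iii)
  is not used.  (`Negative/StubTransferFalseWithoutHsolv.lean`, p110876 ACCEPTED.)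
* **Tightness in `ν`** (lead, `conclusion_const_section`, pending): `Concl` holds for `ν > 2^{-k}`
  (constant section).  Together with `concl_false_of_rate`: the contentful strip is
  `h₂(ν) < (1-ν)2^{-k}` … `ν < 2^{-k}`.

## Findings (generation 2, refuter-cdisprove-stmt-PneNP-2463-g2-0, 2026-08-16) — see `section EtaZero`

* **Still no kill; the state of the crux.**  Since cycle 1 the provers PROVED the conclusion f-free off the
  core region — `α < 2/k` (peeling, `…PeelingAssembly.lean`), `ν > 2^{-k} min(1, e^{kα2^{-k}} - 1)`
  (constant section / one round of local repair), `η ≥ 1` (`…EtaGeOne.lean`, from solvability alone), and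
  the hypothesis is false for `α ≥ 2^k log 2` — and proved items 2462/2464, so that inside the
  Bresler–Huang window the crux is EQUIVALENT to `¬ Solvable k α_k` (an average-case lower bound against
  all of `P`: summit strength; `pneNP_of_solvableImpliesStableSection`, triage r1).  A refutation therefore
  needs, at one `(k ≥ 3, α)` in the residual core `{2/k ≤ α < 2^k log 2} × {0 < η < 1} × {ν small}`, BOTH a
  Lean `IsPolyTime` solver with non-vanishing success (none is constructed in the tree; the copy rule /
  Unit Clause are in the tree only as maps, `…AffineRung*.lean`) AND a theorem that no `ν`-valid
  `ηn`-stable section exists there.  The second half is unknown in print at ANY density where some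
  algorithm provably succeeds: every printed no-stable-algorithm/OGP theorem for k-SAT sits at
  `α ≥ 4.91·2^k ln k/k` (Bresler–Huang 2021), above every proved algorithm (`(1-ε)2^k ln k/k`,
  Coja-Oghlan 2010); the printed "OGP yet easy" examples (random k-XORSAT — Gaussian elimination;
  lattice/LLL recovery beating low degree, Zadik–Song–Wein–Bruna 2022; shortest path with OGP,
  Li–Schramm 2024; paper-level refs recalled — `lit` search was DEGRADED this session: searchd reset,
  OpenAlex/S2 429) are all outside k-SAT and all algebraic/dynamic-programming, i.e. exactly the
  exceptions the route's thesis names.  So the crux keeps resisting for the cycle-1 reason, now sharpened: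
  its only refutable content is "solvable ⇒ stably sectionable" on the residual core, and no candidate
  unstable-but-efficient k-SAT algorithm is known there (SP/BP-decimation are conjectured, not proved, to
  work beyond `2^k ln k/k`, and fail provably at higher density, Coja-Oghlan 2017 / Hetterich 2016).
* **NEW load-bearing analysis: `0 < η` (LANDED, `Negative/FalseAtEtaZero.lean`, p128036 ACCEPTED).**
  `concl_false_of_eta_nonpos`: for `k ≥ 1`, EVERY `α > 0`, `η ≤ 0`, `0 ≤ ν ≤ 1/2` with
  `h₂(ν) < (1-ν)2^{-k}`, `¬ Concl k α η ν`.  A frozen section (`η n ≤ 0`) is constant along sweep 0, so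
  `g (Ψ 0)` — a function of `Ψ 0` alone — must be `ν`-valid for the INDEPENDENT array `Ψ 1`; for a fixed
  assignment only `(⌊νm⌋₊+1)e^{m h₂(ν)}e^{-2^{-k}(1-ν)m}·#Inst` arrays qualify.  No union over assignments, so
  no `2^n` and NO density condition (contrast `concl_false_of_rate`, which needs `α((1-ν)2^{-k}-h₂ν) > log 2 + c`).
  Witness `concl_false_at_eta_zero : ¬ Concl k α 0 8^{-k}` for all `k ≥ 1`, `α > 0`; hence
  `solvableImpliesStableSection_false_with_eta_zero_of : SolvableSomewhere → ¬ (crux with 0 ≤ η)`.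
  With `…EtaGeOne` (η ≥ 1 ⇒ crux) this pins the `η`-range from both ends: the content of the crux is
  exactly the per-step budget `η n`, `0 < η < 1`; at `η = 0` the conclusion fails even on `α < 2/k` where it
  is proved for every `η > 0`.  The obstruction is informational (independence of `Ψ 0`, `Ψ 1`), not
  geometric: it holds below every threshold.
* **NEW tightness, quantitative (`Negative/EndpointsFar.lean`, p128366 ACCEPTED): valid sections travel a
  LINEAR distance per sweep.**  `card_validClose_lt`: if `h₂(β) + c < α((1-ν)2^{-k} - h₂(ν))` then eventually, for every `g`,
  `#{Ψ : g ν-valid along the path ∧ d_H(g(Ψ 0), g(Ψ 1)) ≤ βn} < e^{-cn}·#paths`; `exists_separation`: at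
  `ν = 8^{-k}` some `β(k,α), c > 0` work at every density.  So on the path event the section moves a total
  distance `> βn` along each sweep and the budget `ηn` is spent on `≥ β/η` steps: stability can only come
  from spreading a linear displacement thinly over the `mk` steps (as the landed local/Lipschitz sections
  do), never from rigidity.  (`pathEvent_endpoints_far` below is the `PathEvent` form.)
* **NEW, sharp in `ν` (`Negative/FalseAtEtaZeroSharp.lean`, p128592): frozen sections fail for EVERY
  `0 ≤ ν < 2^{-k}`** (`concl_false_of_eta_nonpos_of_lt`; single-instance count by exponential tilting,
  `#{Φ : violCount σ Φ ≤ J}·t^J ≤ (1 - 2^{-k}(1-t))^m·#Inst`, Chernoff rate `2^{-k} - ν - ν log(2^{-k}/ν)`).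
  With the lead's constant section (`ν > 2^{-k}`, zero movement) the zero-movement regime is completely
  charted: at `η = 0` the conclusion holds iff `ν > 2^{-k}` (boundary aside), at every density,
  solvable or not.  So for `ν < 2^{-k}` — the whole contentful strip — every valid section is a MOVING one.
* **`3 ≤ k` (information).**  `k = 0`: hypothesis unsatisfiable (cycle 1).  `k = 1`: hypothesis false for
  every `α > 0` (random 1-SAT with `⌊αn⌋` unit literals is unsatisfiable w.h.p. — birthday collisions of
  complementary literals; not formalised, routine).  `k = 2`: the conclusion is PROVED for `α < 1 = 2/k`
  (peeling block, stated for `k ≥ 2`), and `Solvable 2 α` is false for `α > 1` (2-SAT threshold,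
  Chvátal–Reed / Goerdt 1992, not in tree); only the scaling-window point `α = 1` (where `Pr[sat]` stays in
  `(0,1)`, Bollobás–Borgs–Chayes–Kim–Wilson 2001, and 2-SAT ∈ P) would carry content.  So `3 ≤ k` excludes
  nothing refutable except possibly `(k, α) = (2, 1)`.
* **Line `Sketch` (v4.2).**  Only `stub_transferCore` is open (the crux on the residual core; the lead
  declared the line dead there, `Lines/Sketch-dead.md`).  Joint sufficiency is kernel-checked
  (`SolvableImpliesStableSection_of` closes the crux from the stub by case analysis).  The stub inherits
  both findings above: its SmoothSection conclusion at `η = 0` (zero jump rate) is false under `hsolv`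
  for the frozen-section reason, and any smooth section it produces must realise the linear sweep
  displacement of `exists_separation` through `Θ(n)`… `O(1)`-size jumps spread over the sweep.
-/


/-! ## Local copies of two tree lemmas
`Local.ind_card_violCount_le` and `Local.cnt_choose_le_exp_binEntropy` below are VERBATIM copies of
`Summit.PneNP.PneNP.Cruxes.NoStableSection.DartGame.ind_card_violCount_le`
(`Theorems/OverlapGapAlgebraNoStableSectionIndep.lean`) and `…DartGame.cnt_choose_le_exp_binEntropy`
(`Theorems/OverlapGapAlgebraNoStableSectionCount.lean`), kept here only because the farm had not yet
built those two modules when this file was written (lean check: `remote:stale:unbuilt`); the master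
copy of this file imports them instead. -/
namespace Summit.PneNP.PneNP.Cruxes.SolvableImpliesStableSection.Disproof.Local

set_option linter.dupNamespace false

open Finset Real
open Summit.PneNP.PneNP.Cruxes.NoStableSection.DartGame (Inst PathSp violCount)

section IndCount

variable {k m n : ℕ}

/-- The clauses falsified by `y` are exactly the `n^k` clauses `r ↦ (v r, ! y (v r))`. -/
theorem ind_card_falsified (y : Fin n → Bool) :
    (univ.filter fun C : Fin k → Fin n × Bool => ∀ r, y (C r).1 ≠ (C r).2).card = n ^ k := by
  have key : (univ.filter fun C : Fin k → Fin n × Bool => ∀ r, y (C r).1 ≠ (C r).2) =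
      univ.map ⟨fun v : Fin k → Fin n => fun r => (v r, !y (v r)), fun v w h => by
        funext r
        simpa using congrArg (fun C : Fin k → Fin n × Bool => (C r).1) h⟩ := by
    ext C
    simp only [mem_filter, mem_univ, true_and, mem_map, Function.Embedding.coeFn_mk]
    constructor
    · intro h
      refine ⟨fun r => (C r).1, funext fun r => Prod.ext rfl ?_⟩
      dsimp only
      have hr := h r
      revert hr
      cases y (C r).1 <;> cases (C r).2 <;> decide
    · rintro ⟨v, rfl⟩ r
      dsimp only
      cases y (v r) <;> decide
  rw [key, card_map, card_univ, Fintype.card_fun, Fintype.card_fin, Fintype.card_fin]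

/-- Hence, as a real number, the clauses NOT falsified by `y` number `(1 - 2^{-k}) · (2n)^k`. -/
theorem ind_card_notFalsified (y : Fin n → Bool) :
    ((univ.filter fun C : Fin k → Fin n × Bool => ¬∀ r, y (C r).1 ≠ (C r).2).card : ℝ) =
      (1 - (1 / 2 : ℝ) ^ k) * Fintype.card (Fin k → Fin n × Bool) := by
  have h := Finset.card_filter_add_card_filter_not (s := (univ : Finset (Fin k → Fin n × Bool)))
    (fun C : Fin k → Fin n × Bool => ∀ r, y (C r).1 ≠ (C r).2)
  rw [ind_card_falsified, card_univ] at h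
  have hcard : Fintype.card (Fin k → Fin n × Bool) = (n * 2) ^ k := by
    rw [Fintype.card_fun, Fintype.card_prod, Fintype.card_fin, Fintype.card_fin, Fintype.card_bool]
  rw [hcard] at h ⊢
  have h' : ((univ.filter fun C : Fin k → Fin n × Bool => ¬∀ r, y (C r).1 ≠ (C r).2).card : ℝ) =
      ((n : ℝ) * 2) ^ k - (n : ℝ) ^ k := by
    have := congrArg (Nat.cast : ℕ → ℝ) h
    push_cast at this
    linarith
  have hpow : (1 / 2 : ℝ) ^ k * ((n : ℝ) * 2) ^ k = (n : ℝ) ^ k := by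
    rw [← mul_pow]
    congr 1
    ring
  rw [h']
  push_cast
  linear_combination hpow

/-- The instances whose clauses outside `S` are not falsified by `y` form a product set of
cardinality `(1 - 2^{-k})^{m - #S} · #Inst`. -/
theorem ind_card_goodOutside (y : Fin n → Bool) (S : Finset (Fin m)) :
    ((Fintype.piFinset fun i : Fin m => if i ∈ S then (univ : Finset (Fin k → Fin n × Bool))
        else univ.filter fun C : Fin k → Fin n × Bool => ¬∀ r, y (C r).1 ≠ (C r).2).card : ℝ) =
      (1 - (1 / 2 : ℝ) ^ k) ^ (m - S.card) * Fintype.card (Inst m k n) := by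
  have hS : (univ.filter fun i : Fin m => i ∈ S) = S := by ext i; simp
  have hSc : (univ.filter fun i : Fin m => ¬i ∈ S) = Sᶜ := by ext i; simp
  rw [Fintype.card_piFinset, prod_congr rfl fun i _ => apply_ite Finset.card (i ∈ S) _ _, prod_ite,
    prod_const, prod_const, hS, hSc, Finset.card_compl, Fintype.card_fin]
  push_cast
  rw [card_univ, ind_card_notFalsified y]
  have hInst : (Fintype.card (Inst m k n) : ℝ) = (Fintype.card (Fin k → Fin n × Bool) : ℝ) ^ m := by
    rw [Fintype.card_fun, Fintype.card_fin]
    push_cast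
    rfl
  have hSm : S.card ≤ m := by simpa using S.card_le_univ
  rw [hInst, mul_pow]
  set N : ℝ := (Fintype.card (Fin k → Fin n × Bool) : ℝ)
  calc N ^ S.card * ((1 - (1 / 2 : ℝ) ^ k) ^ (m - S.card) * N ^ (m - S.card))
      = (1 - (1 / 2 : ℝ) ^ k) ^ (m - S.card) * N ^ (S.card + (m - S.card)) := by rw [pow_add]; ring
    _ = (1 - (1 / 2 : ℝ) ^ k) ^ (m - S.card) * N ^ m := by rw [Nat.add_sub_cancel' hSm]

/-- **Single-instance validity count.** For a fixed assignment `y`, the instances with at most `J`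
clauses violated by `y` number at most `Σ_{j ≤ J} C(m,j) · (1 - 2^{-k})^{m-J} · #Inst`: the set of
violated clause indices has some size `j ≤ J`, and outside it every clause avoids the `n^k`
falsified ones. -/
theorem ind_card_violCount_le (y : Fin n → Bool) (J : ℕ) :
    ((univ.filter fun Φ : Inst m k n => violCount y Φ ≤ J).card : ℝ) ≤
      (∑ j ∈ range (J + 1), (m.choose j : ℝ)) * (1 - (1 / 2 : ℝ) ^ k) ^ (m - J) *
        Fintype.card (Inst m k n) := by
  obtain ⟨G, hG⟩ : ∃ G : Finset (Fin m) → Finset (Inst m k n), ∀ S, G S =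
      Fintype.piFinset fun i : Fin m => if i ∈ S then (univ : Finset (Fin k → Fin n × Bool))
        else univ.filter fun C : Fin k → Fin n × Bool => ¬∀ r, y (C r).1 ≠ (C r).2 :=
    ⟨_, fun _ => rfl⟩
  have hq0 : 0 ≤ 1 - (1 / 2 : ℝ) ^ k := sub_nonneg.2 (pow_le_one₀ (by norm_num) (by norm_num))
  have hq1 : 1 - (1 / 2 : ℝ) ^ k ≤ 1 := sub_le_self _ (by positivity)
  -- the cover by product sets, indexed by the set of violated clauses
  have hsub : (univ.filter fun Φ : Inst m k n => violCount y Φ ≤ J) ⊆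
      (range (J + 1)).biUnion fun j => (powersetCard j univ).biUnion G := by
    intro Φ hΦ
    simp only [mem_filter, mem_univ, true_and] at hΦ
    simp only [mem_biUnion, mem_range, mem_powersetCard]
    refine ⟨violCount y Φ, Nat.lt_succ_of_le hΦ,
      univ.filter fun i : Fin m => ∀ r, y (Φ i r).1 ≠ (Φ i r).2, ⟨subset_univ _, rfl⟩, ?_⟩
    rw [hG, Fintype.mem_piFinset]
    intro i
    split_ifs with hi
    · exact mem_univ _
    · simp only [mem_filter, mem_univ, true_and] at hi ⊢
      exact hi
  have hGcard : ∀ j ∈ range (J + 1), ∀ S ∈ powersetCard j (univ : Finset (Fin m)),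
      ((G S).card : ℝ) ≤ (1 - (1 / 2 : ℝ) ^ k) ^ (m - J) * Fintype.card (Inst m k n) := by
    intro j hj S hS
    rw [mem_powersetCard] at hS
    rw [hG, ind_card_goodOutside]
    refine mul_le_mul_of_nonneg_right (pow_le_pow_of_le_one hq0 hq1 ?_) (Nat.cast_nonneg _)
    have := mem_range.1 hj
    omega
  calc ((univ.filter fun Φ : Inst m k n => violCount y Φ ≤ J).card : ℝ)
      ≤ ∑ j ∈ range (J + 1), ∑ S ∈ powersetCard j (univ : Finset (Fin m)), ((G S).card : ℝ) := by
        exact_mod_cast (card_le_card hsub).trans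
          (card_biUnion_le.trans (sum_le_sum fun j _ => card_biUnion_le))
    _ ≤ ∑ j ∈ range (J + 1), ∑ S ∈ powersetCard j (univ : Finset (Fin m)),
          (1 - (1 / 2 : ℝ) ^ k) ^ (m - J) * Fintype.card (Inst m k n) :=
        sum_le_sum fun j hj => sum_le_sum fun S hS => hGcard j hj S hS
    _ = (∑ j ∈ range (J + 1), (m.choose j : ℝ)) * (1 - (1 / 2 : ℝ) ^ k) ^ (m - J) *
          Fintype.card (Inst m k n) := by
        rw [sum_mul, sum_mul]
        refine sum_congr rfl fun j _ => ?_
        rw [sum_const, card_powersetCard, card_univ, Fintype.card_fin, nsmul_eq_mul]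
        ring


end IndCount

section Count

/-- The crude entropy bound for a binomial coefficient in `binEntropy` form:
`C(N, j) ≤ exp(N · h₂(j/N))` for `0 ≤ j ≤ N` (at `N = 0` both sides are `1`). -/
theorem cnt_choose_le_exp_binEntropy {N j : ℕ} (hjN : j ≤ N) :
    (N.choose j : ℝ) ≤ Real.exp (N * binEntropy ((j : ℝ) / N)) := by
  rcases Nat.eq_zero_or_pos N with rfl | hN
  · obtain rfl : j = 0 := Nat.le_zero.1 hjN
    simp
  have hN' : (0 : ℝ) < N := by exact_mod_cast hN
  have h := Literature.Probability.LatticeModels.choose_le_exp_spinRate hjN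
  rw [Literature.Probability.LatticeModels.spinRate_eq_log_two_sub_binEntropy] at h
  have e : (1 + (2 * (j : ℝ) - N) / N) / 2 = (j : ℝ) / N := by
    field_simp
    ring
  rw [e] at h
  have h2 : Real.exp ((N : ℝ) * Real.log 2) = 2 ^ N := by
    rw [Real.exp_nat_mul, Real.exp_log two_pos]
  calc (N.choose j : ℝ) ≤ 2 ^ N * Real.exp (-(N * (Real.log 2 - binEntropy ((j : ℝ) / N)))) := h
    _ = Real.exp (N * binEntropy ((j : ℝ) / N)) := by
      rw [show -((N : ℝ) * (Real.log 2 - binEntropy ((j : ℝ) / N))) =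
          N * binEntropy ((j : ℝ) / N) - N * Real.log 2 by ring, Real.exp_sub, h2]
      field_simp

end Count

end Summit.PneNP.PneNP.Cruxes.SolvableImpliesStableSection.Disproof.Local

set_option linter.dupNamespace false

namespace Summit.PneNP.PneNP.Cruxes.SolvableImpliesStableSection.Disproof

open Finset Filter
open Summit.PneNP.PneNP.Theses.OverlapGapAlgebra
open Summit.PneNP.PneNP.Cruxes.NoStableSection.DartGame (Inst PathSp violCount)
open Summit.PneNP.PneNP.Cruxes.SolvableImpliesStableSection.Disproof.Local (ind_card_violCount_le
  cnt_choose_le_exp_binEntropy)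

/-! ## The crux, split into hypothesis and conclusion -/

/-- The crux's hypothesis at `(k, α)`: some polynomial-time `f` outputs a satisfying assignment of the
uniformly random instance `Φ : Fin ⌊α n⌋₊ → Fin k → Fin n × Bool` with probability `≥ ε`, for
infinitely many `n` (verbatim the antecedent of `SolvableImpliesStableSection`). -/
def Solvable (k : ℕ) (α : ℝ) : Prop :=
  ∃ f : List Bool → List Bool, Literature.Computability.Complexity.IsPolyTime f ∧ ∃ ε : ℝ, 0 < ε ∧
    ∃ᶠ n : ℕ in Filter.atTop, ∀ m : ℕ, m = ⌊α * n⌋₊ → ε ≤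
      ((Finset.univ.filter fun Φ : Fin m → Fin k → Fin n × Bool => ∀ i, ∃ j,
        (f (Literature.Computability.Complexity.encodingCNF.encode (List.ofFn fun a =>
          List.ofFn fun b => (((Φ a b).1 : ℕ), (Φ a b).2)))).getD (Φ i j).1 false =
            (Φ i j).2).card : ℝ) / Fintype.card (Fin m → Fin k → Fin n × Bool)

/-- The crux's conclusion at `(k, α, η, ν)`: for every `c > 0`, infinitely often some section `g` is
`ν`-valid at every splice point and `η n`-stable at every step of the Bresler–Huang path, on at least
an `e^{-cn}` fraction of path tuples `Ψ` (verbatim the consequent of `SolvableImpliesStableSection`). -/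
def Concl (k : ℕ) (α η ν : ℝ) : Prop :=
  ∀ c : ℝ, 0 < c → ∃ᶠ n : ℕ in Filter.atTop, ∀ m : ℕ, m = ⌊α * n⌋₊ →
    ∃ g : (Fin m → Fin k → Fin n × Bool) → (Fin n → Bool),
      Real.exp (-(c * n)) * Fintype.card (Fin (k + 1) → Fin m → Fin k → Fin n × Bool) ≤
      ((Finset.univ.filter fun Ψ : Fin (k + 1) → Fin m → Fin k → Fin n × Bool =>
        let P : Fin k → ℕ → Fin m → Fin k → Fin n × Bool :=
          fun r q a b => if (a : ℕ) * k + b < q then Ψ r.succ a b else Ψ r.castSucc a b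
        (∀ r : Fin k, ∀ q ≤ m * k, ((Finset.univ.filter fun i : Fin m =>
          ∀ j, g (P r q) (P r q i j).1 ≠ (P r q i j).2).card : ℝ) ≤ ν * m) ∧
        ∀ r : Fin k, ∀ q < m * k,
          (hammingDist (g (P r q)) (g (P r (q + 1))) : ℝ) ≤ η * n).card : ℝ)

/-- The crux is literally `∀ k ≥ 3, ∀ α η ν > 0, Solvable k α → Concl k α η ν`. -/
theorem solvableImpliesStableSection_iff :
    SolvableImpliesStableSection ↔
      ∀ k : ℕ, 3 ≤ k → ∀ α η ν : ℝ, 0 < α → 0 < η → 0 < ν → Solvable k α → Concl k α η ν :=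
  Iff.rfl

/-- The path event of `Concl` at fixed `(k, m, n)`, for a section `g` (the filter predicate, named). -/
def PathEvent (k m n : ℕ) (η ν : ℝ) (g : (Fin m → Fin k → Fin n × Bool) → (Fin n → Bool))
    (Ψ : Fin (k + 1) → Fin m → Fin k → Fin n × Bool) : Prop :=
  let P : Fin k → ℕ → Fin m → Fin k → Fin n × Bool :=
    fun r q a b => if (a : ℕ) * k + b < q then Ψ r.succ a b else Ψ r.castSucc a b
  (∀ r : Fin k, ∀ q ≤ m * k, ((Finset.univ.filter fun i : Fin m =>
    ∀ j, g (P r q) (P r q i j).1 ≠ (P r q i j).2).card : ℝ) ≤ ν * m) ∧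
  ∀ r : Fin k, ∀ q < m * k,
    (hammingDist (g (P r q)) (g (P r (q + 1))) : ℝ) ≤ η * n

/-- The path event is decidable by the same structural instance the crux's `Finset.filter` uses
(reals carry their classical `DecidableLE`), so filters over `PathEvent` are DEFINITIONALLY the crux's. -/
noncomputable instance PathEvent.instDecidablePred (k m n : ℕ) (η ν : ℝ)
    (g : (Fin m → Fin k → Fin n × Bool) → (Fin n → Bool)) : DecidablePred (PathEvent k m n η ν g) :=
  fun Ψ => inferInstanceAs (Decidable ((∀ r : Fin k, ∀ q ≤ m * k, ((Finset.univ.filter fun i : Fin m =>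
    ∀ j, g ((fun (r : Fin k) (q : ℕ) (a : Fin m) (b : Fin k) =>
      if (a : ℕ) * k + b < q then Ψ r.succ a b else Ψ r.castSucc a b) r q)
      (((fun (r : Fin k) (q : ℕ) (a : Fin m) (b : Fin k) =>
        if (a : ℕ) * k + b < q then Ψ r.succ a b else Ψ r.castSucc a b) r q) i j).1 ≠
      (((fun (r : Fin k) (q : ℕ) (a : Fin m) (b : Fin k) =>
        if (a : ℕ) * k + b < q then Ψ r.succ a b else Ψ r.castSucc a b) r q) i j).2).card : ℝ) ≤ ν * m) ∧
    ∀ r : Fin k, ∀ q < m * k,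
      (hammingDist (g ((fun (r : Fin k) (q : ℕ) (a : Fin m) (b : Fin k) =>
        if (a : ℕ) * k + b < q then Ψ r.succ a b else Ψ r.castSucc a b) r q))
        (g ((fun (r : Fin k) (q : ℕ) (a : Fin m) (b : Fin k) =>
        if (a : ℕ) * k + b < q then Ψ r.succ a b else Ψ r.castSucc a b) r (q + 1))) : ℝ) ≤ η * n))

/-- `Concl` restated through `PathEvent` (definitional). -/
theorem concl_iff (k : ℕ) (α η ν : ℝ) :
    Concl k α η ν ↔ ∀ c : ℝ, 0 < c → ∃ᶠ n : ℕ in Filter.atTop, ∀ m : ℕ, m = ⌊α * n⌋₊ →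
      ∃ g : (Fin m → Fin k → Fin n × Bool) → (Fin n → Bool),
        Real.exp (-(c * n)) * Fintype.card (Fin (k + 1) → Fin m → Fin k → Fin n × Bool) ≤
        ((Finset.univ.filter fun Ψ => PathEvent k m n η ν g Ψ).card : ℝ) :=
  Iff.rfl

/-- To deny `Concl` it suffices to bound, eventually in `n` and for EVERY section `g`, the path-event
count strictly below `e^{-cn} · #paths` for one rate `c > 0`. -/
theorem not_concl_of_eventually {k : ℕ} {α η ν : ℝ} (c : ℝ) (hc : 0 < c)
    (h : ∀ᶠ n : ℕ in Filter.atTop, ∀ g : (Fin ⌊α * n⌋₊ → Fin k → Fin n × Bool) → (Fin n → Bool),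
      ((Finset.univ.filter fun Ψ => PathEvent k ⌊α * n⌋₊ n η ν g Ψ).card : ℝ) <
        Real.exp (-(c * n)) * Fintype.card (Fin (k + 1) → Fin ⌊α * n⌋₊ → Fin k → Fin n × Bool)) :
    ¬ Concl k α η ν := by
  intro hC
  obtain ⟨n, hn, hlt⟩ := ((hC c hc).and_eventually h).exists
  obtain ⟨g, hg⟩ := hn _ rfl
  exact absurd hg (not_le.2 (hlt g))

/-! ## Elementary facts about the path event -/

section PathFacts

variable {k m n : ℕ}

/-- The splice point `(r, 0)` of a path is the array `Ψ r` itself. -/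
theorem splice_at_zero (Ψ : Fin (k + 1) → Fin m → Fin k → Fin n × Bool) (r : Fin k) :
    (fun (a : Fin m) (b : Fin k) =>
      if (a : ℕ) * k + b < 0 then Ψ r.succ a b else Ψ r.castSucc a b) = Ψ r.castSucc := by
  funext a b
  simp

/-- On the path event, `g` is `ν`-valid at the origin `Ψ 0` (splice point `(0, 0)`; needs `k ≥ 1`). -/
theorem violCount_origin_le (hk : 1 ≤ k) {η ν : ℝ} {g : (Fin m → Fin k → Fin n × Bool) → (Fin n → Bool)}
    {Ψ : Fin (k + 1) → Fin m → Fin k → Fin n × Bool} (h : PathEvent k m n η ν g Ψ) :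
    (violCount (g (Ψ 0)) (Ψ 0) : ℝ) ≤ ν * m := by
  obtain ⟨hval, -⟩ := h
  have h0 := hval ⟨0, hk⟩ 0 (Nat.zero_le _)
  have hc : (⟨0, hk⟩ : Fin k).castSucc = (0 : Fin (k + 1)) := Fin.ext (by simp)
  have e : (fun (a : Fin m) (b : Fin k) => if (a : ℕ) * k + b < 0 then Ψ (⟨0, hk⟩ : Fin k).succ a b
      else Ψ (⟨0, hk⟩ : Fin k).castSucc a b) = Ψ 0 := by
    funext a b
    simp [hc]
  beta_reduce at h0
  rw [e] at h0
  exact h0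

/-- On the path event, the first step of the path moves `g` by at most `η n` (needs a step: `m k ≥ 1`). -/
theorem dist_first_step_le (hk : 1 ≤ k) (hmk : 1 ≤ m * k) {η ν : ℝ}
    {g : (Fin m → Fin k → Fin n × Bool) → (Fin n → Bool)}
    {Ψ : Fin (k + 1) → Fin m → Fin k → Fin n × Bool} (h : PathEvent k m n η ν g Ψ) :
    ∃ x y : Fin n → Bool, (hammingDist x y : ℝ) ≤ η * n := by
  obtain ⟨-, hstab⟩ := h
  exact ⟨_, _, hstab ⟨0, hk⟩ 0 hmk⟩

end PathFacts

/-! ## Degenerate parameters: which sign hypotheses carry content -/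

/-- For `α > 0`, eventually `⌊α n⌋₊ ≥ R`. -/
theorem eventually_floor_ge {α : ℝ} (hα : 0 < α) (R : ℕ) :
    ∀ᶠ n : ℕ in Filter.atTop, R ≤ ⌊α * n⌋₊ :=
  (tendsto_nat_floor_atTop.comp (tendsto_natCast_atTop_atTop.const_mul_atTop hα)).eventually_ge_atTop R

/-- `0 < α` is decoration: for `α ≤ 0` every `m = ⌊α n⌋₊` vanishes, the path space is a singleton and
the unique path is valid and stable for every `g`, so `Concl` holds for all `n`. -/
theorem concl_of_nonpos (k : ℕ) {α : ℝ} (hα : α ≤ 0) (η ν : ℝ) : Concl k α η ν := by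
  intro c hc
  refine Filter.Eventually.frequently (Filter.Eventually.of_forall fun n m hm => ?_)
  have hfl : ⌊α * (n : ℝ)⌋₊ = 0 :=
    Nat.floor_eq_zero.2 (by nlinarith [Nat.cast_nonneg (α := ℝ) n])
  rw [hfl] at hm
  subst hm
  refine ⟨fun _ _ => false, ?_⟩
  rw [Finset.filter_true_of_mem, Finset.card_univ]
  · have h1 : Real.exp (-(c * n)) ≤ 1 := Real.exp_le_one_iff.2 (by
      have : (0 : ℝ) ≤ c * n := by positivity
      linarith)
    exact mul_le_of_le_one_left (Nat.cast_nonneg _) h1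
  · intro Ψ _
    refine ⟨fun r q _ => ?_, fun r q hq => ?_⟩
    · simp
    · omega

/-- At `k = 0` (empty clauses) no output ever satisfies a clause, so `Solvable 0 α` fails for `α > 0`:
the restriction `3 ≤ k` excludes nothing refutable at `k = 0`. -/
theorem not_solvable_zero {α : ℝ} (hα : 0 < α) : ¬ Solvable 0 α := by
  rintro ⟨f, -, ε, hε, hfreq⟩
  obtain ⟨n, hn, hm⟩ := (hfreq.and_eventually (eventually_floor_ge hα 1)).exists
  have h := hn _ rfl
  rw [Finset.filter_false_of_mem, Finset.card_empty, Nat.cast_zero, zero_div] at h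
  · exact absurd h (not_le.2 hε)
  · intro Φ _ hΦ
    obtain ⟨j, -⟩ := hΦ ⟨0, hm⟩
    exact j.elim0

/-- For `n ≥ 1` the path space is nonempty, so its cardinality is positive. -/
theorem card_paths_pos (k m : ℕ) {n : ℕ} (hn : 1 ≤ n) :
    (0 : ℝ) < Fintype.card (Fin (k + 1) → Fin m → Fin k → Fin n × Bool) := by
  haveI : Nonempty (Fin n × Bool) := ⟨(⟨0, hn⟩, false)⟩
  exact_mod_cast Fintype.card_pos

/-- For `η < 0` the stability requirement is unsatisfiable as soon as the path has a step
(`m k ≥ 1`), so `Concl` fails (trivial; `0 < η` only excludes this). -/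
theorem concl_false_of_eta_neg {k : ℕ} (hk : 1 ≤ k) {α η : ℝ} (hα : 0 < α) (hη : η < 0) (ν : ℝ) :
    ¬ Concl k α η ν := by
  refine not_concl_of_eventually 1 one_pos ?_
  filter_upwards [eventually_floor_ge hα 1, Filter.eventually_ge_atTop 1] with n hm hn1 g
  have hcard := card_paths_pos k ⌊α * (n : ℝ)⌋₊ hn1
  have hempty : (Finset.univ.filter fun Ψ => PathEvent k ⌊α * (n : ℝ)⌋₊ n η ν g Ψ) = ∅ := by
    refine Finset.filter_false_of_mem fun Ψ _ hΨ => ?_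
    obtain ⟨x, y, hxy⟩ := dist_first_step_le hk (Nat.mul_pos hm hk) hΨ
    have h0 : (0 : ℝ) ≤ hammingDist x y := by exact_mod_cast hammingDist_nonneg
    have hn' : (0 : ℝ) < n := by exact_mod_cast hn1
    nlinarith
  rw [hempty, Finset.card_empty, Nat.cast_zero]
  exact mul_pos (Real.exp_pos _) hcard

/-- For `ν < 0` the validity requirement is unsatisfiable as soon as `m ≥ 1`, so `Concl` fails
(trivial; `0 < ν` only excludes this). -/
theorem concl_false_of_nu_neg {k : ℕ} (hk : 1 ≤ k) {α ν : ℝ} (hα : 0 < α) (hν : ν < 0) (η : ℝ) :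
    ¬ Concl k α η ν := by
  refine not_concl_of_eventually 1 one_pos ?_
  filter_upwards [eventually_floor_ge hα 1, Filter.eventually_ge_atTop 1] with n hm hn1 g
  have hcard := card_paths_pos k ⌊α * (n : ℝ)⌋₊ hn1
  have hempty : (Finset.univ.filter fun Ψ => PathEvent k ⌊α * (n : ℝ)⌋₊ n η ν g Ψ) = ∅ := by
    refine Finset.filter_false_of_mem fun Ψ _ hΨ => ?_
    have hv := violCount_origin_le hk hΨ
    have h0 : (0 : ℝ) ≤ violCount (g (Ψ 0)) (Ψ 0) := Nat.cast_nonneg _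
    have hm' : (1 : ℝ) ≤ ⌊α * (n : ℝ)⌋₊ := by exact_mod_cast hm
    nlinarith
  rw [hempty, Finset.card_empty, Nat.cast_zero]
  exact mul_pos (Real.exp_pos _) hcard

/-! ## The solvability hypothesis is load-bearing: no near-valid section in the unsatisfiable phase -/

section FirstMoment

variable {k m n : ℕ}

/-- Product decomposition: a predicate on the origin `Ψ 0` cuts out `#{Φ : p Φ} · #Inst^k` paths. -/
theorem card_filter_origin (p : (Fin m → Fin k → Fin n × Bool) → Prop) [DecidablePred p] :
    (Finset.univ.filter fun Ψ : Fin (k + 1) → Fin m → Fin k → Fin n × Bool => p (Ψ 0)).card =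
      (Finset.univ.filter p).card * (Fintype.card (Fin m → Fin k → Fin n × Bool)) ^ k := by
  have key : (Finset.univ.filter fun Ψ : Fin (k + 1) → Fin m → Fin k → Fin n × Bool => p (Ψ 0)) =
      Fintype.piFinset fun i : Fin (k + 1) =>
        if i = 0 then Finset.univ.filter p else (Finset.univ : Finset (Fin m → Fin k → Fin n × Bool)) := by
    ext Ψ
    simp only [Finset.mem_filter, Finset.mem_univ, true_and, Fintype.mem_piFinset]
    constructor
    · intro h i
      split_ifs with hi
      · subst hi
        simpa using h
      · exact Finset.mem_univ _
    · intro h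
      simpa using h 0
  rw [key, Fintype.card_piFinset, Fin.prod_univ_succ]
  simp [Fin.succ_ne_zero, Finset.prod_const, Finset.card_univ]

/-- Union bound over an index type. -/
theorem card_filter_exists_le {α ι : Type*} [Fintype α] [Fintype ι] (P : ι → α → Prop)
    [∀ i, DecidablePred (P i)] [DecidablePred fun a => ∃ i, P i a] :
    (Finset.univ.filter fun a => ∃ i, P i a).card ≤ ∑ i, (Finset.univ.filter (P i)).card := by
  classical
  calc (Finset.univ.filter fun a => ∃ i, P i a).card
      ≤ ((Finset.univ : Finset ι).biUnion fun i => Finset.univ.filter (P i)).card := by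
        refine Finset.card_le_card fun a ha => ?_
        simp only [Finset.mem_filter, Finset.mem_univ, true_and] at ha
        obtain ⟨i, hi⟩ := ha
        exact Finset.mem_biUnion.2 ⟨i, Finset.mem_univ _, by simpa using hi⟩
    _ ≤ ∑ i, (Finset.univ.filter (P i)).card := Finset.card_biUnion_le

/-- Entropy bound for the partial binomial sum: `Σ_{j ≤ J} C(m, j) ≤ (J+1) e^{m h₂(ν)}` when
`J ≤ ν m`, `0 ≤ ν ≤ 1/2`. -/
theorem sum_choose_le_exp_binEntropy {J : ℕ} {ν : ℝ} (hν0 : 0 ≤ ν) (hν2 : ν ≤ 2⁻¹)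
    (hJ : (J : ℝ) ≤ ν * m) :
    ∑ j ∈ Finset.range (J + 1), (m.choose j : ℝ) ≤ (J + 1) * Real.exp (m * Real.binEntropy ν) := by
  have hνI : ν ∈ Set.Icc (0 : ℝ) 2⁻¹ := ⟨hν0, hν2⟩
  have hterm : ∀ j ∈ Finset.range (J + 1), (m.choose j : ℝ) ≤ Real.exp (m * Real.binEntropy ν) := by
    intro j hj
    have hjJ : j ≤ J := Nat.lt_succ_iff.1 (Finset.mem_range.1 hj)
    have hjR : (j : ℝ) ≤ ν * m := le_trans (by exact_mod_cast hjJ) hJ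
    have hjm : j ≤ m := by
      have : (j : ℝ) ≤ m := hjR.trans (by nlinarith [Nat.cast_nonneg (α := ℝ) m])
      exact_mod_cast this
    refine (cnt_choose_le_exp_binEntropy hjm).trans (Real.exp_le_exp.2 ?_)
    rcases Nat.eq_zero_or_pos m with hm0 | hmpos
    · subst hm0; simp
    have hm' : (0 : ℝ) < m := by exact_mod_cast hmpos
    refine mul_le_mul_of_nonneg_left ?_ (Nat.cast_nonneg _)
    have hq0 : 0 ≤ (j : ℝ) / m := by positivity
    have hqν : (j : ℝ) / m ≤ ν := by
      rw [div_le_iff₀ hm']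
      exact hjR
    exact Real.binEntropy_strictMonoOn.monotoneOn ⟨hq0, hqν.trans hν2⟩ hνI hqν
  calc ∑ j ∈ Finset.range (J + 1), (m.choose j : ℝ)
      ≤ ∑ _j ∈ Finset.range (J + 1), Real.exp (m * Real.binEntropy ν) := Finset.sum_le_sum hterm
    _ = (J + 1) * Real.exp (m * Real.binEntropy ν) := by
        rw [Finset.sum_const, Finset.card_range, nsmul_eq_mul]
        push_cast
        ring

/-- Geometric factor: `(1 - 2^{-k})^{m - J} ≤ e^{-2^{-k} (m - J)}`. -/
theorem one_sub_pow_le_exp {J : ℕ} (hJm : J ≤ m) :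
    (1 - (1 / 2 : ℝ) ^ k) ^ (m - J) ≤ Real.exp (-((1 / 2 : ℝ) ^ k * ((m : ℝ) - J))) := by
  have hp1 : (1 / 2 : ℝ) ^ k ≤ 1 := pow_le_one₀ (by norm_num) (by norm_num)
  have h0 : 0 ≤ 1 - (1 / 2 : ℝ) ^ k := sub_nonneg.2 hp1
  calc (1 - (1 / 2 : ℝ) ^ k) ^ (m - J)
      ≤ (Real.exp (-((1 / 2 : ℝ) ^ k))) ^ (m - J) :=
        pow_le_pow_left₀ h0 (Real.one_sub_le_exp_neg _) _
    _ = Real.exp (-((1 / 2 : ℝ) ^ k * ((m : ℝ) - J))) := by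
        rw [← Real.exp_nat_mul, Nat.cast_sub hJm]
        ring_nf

/-- **First-moment count.** For any section `g` and `0 ≤ ν ≤ 1/2`, the paths on which `g` is merely
`ν`-valid at the origin — in particular all paths of the path event — number at most
`2^n · (⌊ν m⌋₊ + 1) · e^{m h₂(ν)} · e^{-2^{-k}(1-ν) m} · #paths`. -/
theorem card_pathEvent_le (hk : 1 ≤ k) {η ν : ℝ} (hν0 : 0 ≤ ν) (hν2 : ν ≤ 2⁻¹)
    (g : (Fin m → Fin k → Fin n × Bool) → (Fin n → Bool)) :
    ((Finset.univ.filter fun Ψ => PathEvent k m n η ν g Ψ).card : ℝ) ≤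
      (2 : ℝ) ^ n * ((⌊ν * m⌋₊ + 1) * Real.exp (m * Real.binEntropy ν)) *
        Real.exp (-((1 / 2 : ℝ) ^ k * ((1 - ν) * m))) *
        Fintype.card (Fin (k + 1) → Fin m → Fin k → Fin n × Bool) := by
  classical
  set J : ℕ := ⌊ν * m⌋₊ with hJdef
  have hJ : (J : ℝ) ≤ ν * m := Nat.floor_le (by positivity)
  have hJm : J ≤ m := by
    have : (J : ℝ) ≤ m := hJ.trans (by nlinarith [Nat.cast_nonneg (α := ℝ) m])
    exact_mod_cast this
  -- (a) the path event forces `ν`-validity of `g (Ψ 0)` at the origin, hence some `J`-valid `y`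
  have hsub : (Finset.univ.filter fun Ψ => PathEvent k m n η ν g Ψ) ⊆
      Finset.univ.filter fun Ψ : Fin (k + 1) → Fin m → Fin k → Fin n × Bool =>
        ∃ y : Fin n → Bool, violCount y (Ψ 0) ≤ J := by
    intro Ψ hΨ
    simp only [Finset.mem_filter, Finset.mem_univ, true_and] at hΨ ⊢
    exact ⟨g (Ψ 0), Nat.le_floor (violCount_origin_le hk hΨ)⟩
  -- (b) product decomposition and (c) union bound over `y` with the single-instance count
  have hInst : ((Finset.univ.filter fun Φ : Fin m → Fin k → Fin n × Bool =>
      ∃ y : Fin n → Bool, violCount y Φ ≤ J).card : ℝ) ≤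
      (2 : ℝ) ^ n * ((∑ j ∈ Finset.range (J + 1), (m.choose j : ℝ)) * (1 - (1 / 2 : ℝ) ^ k) ^ (m - J) *
        Fintype.card (Fin m → Fin k → Fin n × Bool)) := by
    calc ((Finset.univ.filter fun Φ : Fin m → Fin k → Fin n × Bool =>
          ∃ y : Fin n → Bool, violCount y Φ ≤ J).card : ℝ)
        ≤ ∑ y : Fin n → Bool, ((Finset.univ.filter fun Φ : Fin m → Fin k → Fin n × Bool =>
            violCount y Φ ≤ J).card : ℝ) := by
          exact_mod_cast card_filter_exists_le (fun (y : Fin n → Bool) (Φ : Fin m → Fin k → Fin n × Bool) =>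
            violCount y Φ ≤ J)
      _ ≤ ∑ _y : Fin n → Bool, (∑ j ∈ Finset.range (J + 1), (m.choose j : ℝ)) *
            (1 - (1 / 2 : ℝ) ^ k) ^ (m - J) * Fintype.card (Fin m → Fin k → Fin n × Bool) :=
          Finset.sum_le_sum fun y _ => ind_card_violCount_le y J
      _ = (2 : ℝ) ^ n * ((∑ j ∈ Finset.range (J + 1), (m.choose j : ℝ)) * (1 - (1 / 2 : ℝ) ^ k) ^ (m - J) *
            Fintype.card (Fin m → Fin k → Fin n × Bool)) := by
          rw [Finset.sum_const, Finset.card_univ, Fintype.card_fun, Fintype.card_bool, Fintype.card_fin,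
            nsmul_eq_mul]
          push_cast
          ring
  -- (d) the two analytic factors
  have hS := sum_choose_le_exp_binEntropy (m := m) hν0 hν2 hJ
  have hG : (1 - (1 / 2 : ℝ) ^ k) ^ (m - J) ≤ Real.exp (-((1 / 2 : ℝ) ^ k * ((1 - ν) * m))) := by
    refine (one_sub_pow_le_exp hJm).trans (Real.exp_le_exp.2 ?_)
    have hp0 : 0 ≤ (1 / 2 : ℝ) ^ k := by positivity
    nlinarith
  -- assemble
  have hcardI : (0 : ℝ) ≤ Fintype.card (Fin m → Fin k → Fin n × Bool) := Nat.cast_nonneg _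
  have hsum0 : 0 ≤ ∑ j ∈ Finset.range (J + 1), (m.choose j : ℝ) :=
    Finset.sum_nonneg fun _ _ => Nat.cast_nonneg _
  have hgeom0 : 0 ≤ (1 - (1 / 2 : ℝ) ^ k) ^ (m - J) :=
    pow_nonneg (sub_nonneg.2 (pow_le_one₀ (by norm_num) (by norm_num))) _
  have hpaths : (Fintype.card (Fin (k + 1) → Fin m → Fin k → Fin n × Bool) : ℝ) =
      Fintype.card (Fin m → Fin k → Fin n × Bool) *
        (Fintype.card (Fin m → Fin k → Fin n × Bool) : ℝ) ^ k := by
    rw [Fintype.card_fun (α := Fin (k + 1)), Fintype.card_fin, pow_succ']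
    push_cast
    ring
  calc ((Finset.univ.filter fun Ψ => PathEvent k m n η ν g Ψ).card : ℝ)
      ≤ ((Finset.univ.filter fun Ψ : Fin (k + 1) → Fin m → Fin k → Fin n × Bool =>
          ∃ y : Fin n → Bool, violCount y (Ψ 0) ≤ J).card : ℝ) := by
        exact_mod_cast Finset.card_le_card hsub
    _ = ((Finset.univ.filter fun Φ : Fin m → Fin k → Fin n × Bool =>
          ∃ y : Fin n → Bool, violCount y Φ ≤ J).card : ℝ) *
          (Fintype.card (Fin m → Fin k → Fin n × Bool) : ℝ) ^ k := by
        rw [card_filter_origin (fun Φ : Fin m → Fin k → Fin n × Bool => ∃ y : Fin n → Bool, violCount y Φ ≤ J)]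
        push_cast
        ring
    _ ≤ (2 : ℝ) ^ n * ((∑ j ∈ Finset.range (J + 1), (m.choose j : ℝ)) * (1 - (1 / 2 : ℝ) ^ k) ^ (m - J) *
          Fintype.card (Fin m → Fin k → Fin n × Bool)) *
          (Fintype.card (Fin m → Fin k → Fin n × Bool) : ℝ) ^ k :=
        mul_le_mul_of_nonneg_right hInst (by positivity)
    _ ≤ (2 : ℝ) ^ n * (((J + 1) * Real.exp (m * Real.binEntropy ν)) *
          Real.exp (-((1 / 2 : ℝ) ^ k * ((1 - ν) * m))) *
          Fintype.card (Fin m → Fin k → Fin n × Bool)) *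
          (Fintype.card (Fin m → Fin k → Fin n × Bool) : ℝ) ^ k := by
        gcongr
    _ = _ := by rw [hpaths]; ring

/-- `log x = o(x)` made effective along the naturals: for `δ > 0`, eventually `log n ≤ δ n`. -/
theorem eventually_log_le_mul {δ : ℝ} (hδ : 0 < δ) :
    ∀ᶠ n : ℕ in Filter.atTop, Real.log n ≤ δ * n := by
  have h := Real.isLittleO_log_id_atTop.bound hδ
  filter_upwards [tendsto_natCast_atTop_atTop.eventually h] with n hn
  have hn' : |Real.log n| ≤ δ * |(n : ℝ)| := by simpa only [Real.norm_eq_abs, id] using hn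
  have h2 : |(n : ℝ)| = n := abs_of_nonneg (Nat.cast_nonneg n)
  rw [h2] at hn'
  exact (le_abs_self _).trans hn'

/-- **Analytic comparison.** Under the rate condition `log 2 + c < α ((1-ν) 2^{-k} - h₂(ν))`, the
first-moment bound is eventually below `e^{-cn}`. -/
theorem eventually_firstMoment_lt {α ν c : ℝ} (hα : 0 < α) (hν0 : 0 ≤ ν) (hν2 : ν ≤ 2⁻¹)
    (hc : 0 < c)
    (hrate : Real.log 2 + c < α * ((1 - ν) * (1 / 2) ^ k - Real.binEntropy ν)) :
    ∀ᶠ n : ℕ in Filter.atTop,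
      (2 : ℝ) ^ n * ((⌊ν * ⌊α * n⌋₊⌋₊ + 1) * Real.exp (⌊α * n⌋₊ * Real.binEntropy ν)) *
        Real.exp (-((1 / 2 : ℝ) ^ k * ((1 - ν) * ⌊α * n⌋₊))) < Real.exp (-(c * n)) := by
  set R : ℝ := (1 - ν) * (1 / 2) ^ k - Real.binEntropy ν with hR
  set γ : ℝ := α * R - Real.log 2 - c with hγ
  have hγpos : 0 < γ := by rw [hγ]; linarith
  have hlog2 : 0 < Real.log 2 := Real.log_pos one_lt_two
  have hRpos : 0 < R := by
    have hc' : Real.log 2 + c < α * R := hrate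
    by_contra hR0
    have hR0' : R ≤ 0 := le_of_not_gt hR0
    have : α * R ≤ 0 := mul_nonpos_of_nonneg_of_nonpos hα.le hR0'
    nlinarith
  filter_upwards [eventually_log_le_mul (show 0 < γ / 4 by positivity),
    Filter.eventually_ge_atTop (⌈(Real.log (α + 1) + R) * (4 / γ)⌉₊ + 1)] with n hlog hn
  have hn1 : (1 : ℝ) ≤ n := by exact_mod_cast le_trans (Nat.le_add_left 1 _) hn
  have hnpos : (0 : ℝ) < n := by linarith
  -- the number of clauses `M = ⌊α n⌋₊` satisfies `α n - 1 < M ≤ α n`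
  set M : ℕ := ⌊α * (n : ℝ)⌋₊ with hM
  have hMle : (M : ℝ) ≤ α * n := Nat.floor_le (by positivity)
  have hMgt : α * n - 1 < M := by
    have := Nat.lt_floor_add_one (α * (n : ℝ))
    linarith
  -- `J + 1 ≤ (α + 1) n`
  have hJle : (⌊ν * (M : ℝ)⌋₊ : ℝ) + 1 ≤ (α + 1) * n := by
    have h1 : (⌊ν * (M : ℝ)⌋₊ : ℝ) ≤ ν * M := Nat.floor_le (by positivity)
    have h2 : ν * (M : ℝ) ≤ M := by nlinarith [Nat.cast_nonneg (α := ℝ) M]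
    nlinarith
  have hαn : 0 < (α + 1) * n := by positivity
  -- `log ((α+1) n) + R ≤ (γ/2) n` for `n` large
  have hconst : Real.log (α + 1) + R ≤ γ / 4 * n := by
    have h1 : ((⌈(Real.log (α + 1) + R) * (4 / γ)⌉₊ : ℕ) : ℝ) + 1 ≤ n := by exact_mod_cast hn
    have h2 : (Real.log (α + 1) + R) * (4 / γ) ≤ ⌈(Real.log (α + 1) + R) * (4 / γ)⌉₊ := Nat.le_ceil _
    have h3 : (Real.log (α + 1) + R) * (4 / γ) ≤ n := by linarith
    have := (mul_le_mul_of_nonneg_right h3 (show 0 ≤ γ / 4 by positivity))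
    have h4 : (Real.log (α + 1) + R) * (4 / γ) * (γ / 4) = Real.log (α + 1) + R := by
      field_simp
    linarith
  -- everything as a single exponential
  have h2n : (2 : ℝ) ^ n = Real.exp (n * Real.log 2) := by
    rw [Real.exp_nat_mul, Real.exp_log two_pos]
  have hJexp : (⌊ν * (M : ℝ)⌋₊ : ℝ) + 1 ≤ Real.exp (Real.log (α + 1) + Real.log n) := by
    rw [Real.exp_add, Real.exp_log (by positivity), Real.exp_log hnpos]
    exact hJle
  have hJ0 : (0 : ℝ) ≤ (⌊ν * (M : ℝ)⌋₊ : ℝ) + 1 := by positivity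
  calc (2 : ℝ) ^ n * (((⌊ν * (M : ℝ)⌋₊ : ℝ) + 1) * Real.exp (M * Real.binEntropy ν)) *
        Real.exp (-((1 / 2 : ℝ) ^ k * ((1 - ν) * M)))
      ≤ Real.exp (n * Real.log 2) * (Real.exp (Real.log (α + 1) + Real.log n) *
          Real.exp (M * Real.binEntropy ν)) * Real.exp (-((1 / 2 : ℝ) ^ k * ((1 - ν) * M))) := by
        rw [h2n]
        gcongr
    _ = Real.exp (n * Real.log 2 + (Real.log (α + 1) + Real.log n) - M * R) := by
        rw [← Real.exp_add, ← Real.exp_add, ← Real.exp_add, hR]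
        ring_nf
    _ < Real.exp (-(c * n)) := Real.exp_lt_exp.2 (by nlinarith)

/-- **First moment in the unsatisfiable phase.** For `k ≥ 1`, `0 ≤ ν ≤ 1/2`, `c > 0` and a density with
`log 2 + c < α · ((1 - ν) 2^{-k} - h₂(ν))`, the conclusion `Concl k α η ν` is FALSE for every `η`:
eventually, for every section `g`, the paths `Ψ` on which `g` is merely `ν`-valid at the origin
`Ψ 0` number at most `2^n · (⌊ν m⌋₊ + 1) e^{m h₂(ν)} e^{-2^{-k}(1 - ν) m} · #paths < e^{-cn} · #paths`
(union over the `2^n` assignments of the single-instance count `ind_card_violCount_le`, binomials by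
`cnt_choose_le_exp_binEntropy`). -/
theorem concl_false_of_rate (hk : 1 ≤ k) {α ν c : ℝ} (hα : 0 < α) (hν0 : 0 ≤ ν)
    (hν2 : ν ≤ 2⁻¹) (hc : 0 < c)
    (hrate : Real.log 2 + c < α * ((1 - ν) * (1 / 2) ^ k - Real.binEntropy ν)) (η : ℝ) :
    ¬ Concl k α η ν := by
  refine not_concl_of_eventually c hc ?_
  filter_upwards [eventually_firstMoment_lt (k := k) hα hν0 hν2 hc hrate, Filter.eventually_ge_atTop 1]
    with n hlt hn1 g
  have hcard := card_paths_pos k ⌊α * (n : ℝ)⌋₊ hn1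
  have hle := card_pathEvent_le (m := ⌊α * (n : ℝ)⌋₊) (n := n) hk (η := η) hν0 hν2 g
  have := mul_lt_mul_of_pos_right hlt hcard
  linarith

end FirstMoment

/-- The crux with the solvability hypothesis deleted ("stable sections always exist"). -/
def SolvableImpliesStableSectionWithoutSolvable : Prop :=
  ∀ k : ℕ, 3 ≤ k → ∀ α η ν : ℝ, 0 < α → 0 < η → 0 < ν → Concl k α η ν

/-- Numerical entropy bound at the witness: `h₂(1/128) ≤ (7 log 2 + 1)/128`. -/
theorem binEntropy_inv128_le : Real.binEntropy (1 / 128) ≤ (7 * Real.log 2 + 1) / 128 := by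
  have h128 : ((1 : ℝ) / 128)⁻¹ = 2 ^ 7 := by norm_num
  have h1 : (1 - (1 : ℝ) / 128)⁻¹ = 128 / 127 := by norm_num
  have hlog : Real.log ((128 : ℝ) / 127) ≤ 128 / 127 - 1 := Real.log_le_sub_one_of_pos (by norm_num)
  simp only [Real.binEntropy, h128, h1, Real.log_pow]
  push_cast
  nlinarith [hlog]

/-- **`Solvable` is load-bearing.** Witness `k = 3`, `α = 32`, `η = 1`, `ν = 1/128`, rate `c = 1`:
`h₂(1/128) ≤ (7 log 2 + 1)/128 < 0.046` and `log 2 + 1 < 32 · ((127/128)/8 - 0.046)`. -/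
theorem solvableImpliesStableSection_false_without_solvable :
    ¬ SolvableImpliesStableSectionWithoutSolvable := by
  intro h
  have hC := h 3 (by norm_num) 32 1 (1 / 128) (by norm_num) one_pos (by norm_num)
  refine concl_false_of_rate (k := 3) (by norm_num) (by norm_num) (by norm_num) (by norm_num) one_pos
    ?_ 1 hC
  have h2 := Real.log_two_lt_d9
  have hH := binEntropy_inv128_le
  nlinarith


/-! ## Targets — line `Sketch` (lead prover-line-stmt-PneNP-2463-0): `stub_transfer` minus `hsolv` -/

section Targets

variable {k m n : ℕ}

/-- **Instance-level first moment.** For any map `g` and `0 ≤ ν ≤ 1/2`, the instances `Φ` on which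
`g Φ` violates at most `ν m` clauses number at most
`2^n · (⌊ν m⌋₊ + 1) · e^{m h₂(ν)} · e^{-2^{-k}(1-ν) m} · #Inst`. -/
theorem card_instValid_le {ν : ℝ} (hν0 : 0 ≤ ν) (hν2 : ν ≤ 2⁻¹)
    (g : (Fin m → Fin k → Fin n × Bool) → (Fin n → Bool)) :
    ((Finset.univ.filter fun Φ : Fin m → Fin k → Fin n × Bool =>
        (violCount (g Φ) Φ : ℝ) ≤ ν * m).card : ℝ) ≤
      (2 : ℝ) ^ n * ((⌊ν * m⌋₊ + 1) * Real.exp (m * Real.binEntropy ν)) *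
        Real.exp (-((1 / 2 : ℝ) ^ k * ((1 - ν) * m))) *
        Fintype.card (Fin m → Fin k → Fin n × Bool) := by
  classical
  set J : ℕ := ⌊ν * m⌋₊ with hJdef
  have hJ : (J : ℝ) ≤ ν * m := Nat.floor_le (by positivity)
  have hJm : J ≤ m := by
    have : (J : ℝ) ≤ m := hJ.trans (by nlinarith [Nat.cast_nonneg (α := ℝ) m])
    exact_mod_cast this
  have hsub : (Finset.univ.filter fun Φ : Fin m → Fin k → Fin n × Bool =>
        (violCount (g Φ) Φ : ℝ) ≤ ν * m) ⊆
      Finset.univ.filter fun Φ : Fin m → Fin k → Fin n × Bool =>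
        ∃ y : Fin n → Bool, violCount y Φ ≤ J := by
    intro Φ hΦ
    simp only [Finset.mem_filter, Finset.mem_univ, true_and] at hΦ ⊢
    exact ⟨g Φ, Nat.le_floor hΦ⟩
  have hS := sum_choose_le_exp_binEntropy (m := m) hν0 hν2 hJ
  have hG : (1 - (1 / 2 : ℝ) ^ k) ^ (m - J) ≤ Real.exp (-((1 / 2 : ℝ) ^ k * ((1 - ν) * m))) := by
    refine (one_sub_pow_le_exp hJm).trans (Real.exp_le_exp.2 ?_)
    have hp0 : 0 ≤ (1 / 2 : ℝ) ^ k := by positivity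
    nlinarith
  have hsum0 : 0 ≤ ∑ j ∈ Finset.range (J + 1), (m.choose j : ℝ) :=
    Finset.sum_nonneg fun _ _ => Nat.cast_nonneg _
  have hgeom0 : 0 ≤ (1 - (1 / 2 : ℝ) ^ k) ^ (m - J) :=
    pow_nonneg (sub_nonneg.2 (pow_le_one₀ (by norm_num) (by norm_num))) _
  calc ((Finset.univ.filter fun Φ : Fin m → Fin k → Fin n × Bool =>
        (violCount (g Φ) Φ : ℝ) ≤ ν * m).card : ℝ)
      ≤ ((Finset.univ.filter fun Φ : Fin m → Fin k → Fin n × Bool =>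
          ∃ y : Fin n → Bool, violCount y Φ ≤ J).card : ℝ) := by
        exact_mod_cast Finset.card_le_card hsub
    _ ≤ ∑ y : Fin n → Bool, ((Finset.univ.filter fun Φ : Fin m → Fin k → Fin n × Bool =>
          violCount y Φ ≤ J).card : ℝ) := by
        exact_mod_cast card_filter_exists_le (fun (y : Fin n → Bool) (Φ : Fin m → Fin k → Fin n × Bool) =>
          violCount y Φ ≤ J)
    _ ≤ ∑ _y : Fin n → Bool, (∑ j ∈ Finset.range (J + 1), (m.choose j : ℝ)) *
          (1 - (1 / 2 : ℝ) ^ k) ^ (m - J) * Fintype.card (Fin m → Fin k → Fin n × Bool) :=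
        Finset.sum_le_sum fun y _ => ind_card_violCount_le y J
    _ = (2 : ℝ) ^ n * ((∑ j ∈ Finset.range (J + 1), (m.choose j : ℝ)) * (1 - (1 / 2 : ℝ) ^ k) ^ (m - J) *
          Fintype.card (Fin m → Fin k → Fin n × Bool)) := by
        rw [Finset.sum_const, Finset.card_univ, Fintype.card_fun, Fintype.card_bool, Fintype.card_fin,
          nsmul_eq_mul]
        push_cast
        ring
    _ ≤ (2 : ℝ) ^ n * (((J + 1) * Real.exp (m * Real.binEntropy ν)) *
          Real.exp (-((1 / 2 : ℝ) ^ k * ((1 - ν) * m))) *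
          Fintype.card (Fin m → Fin k → Fin n × Bool)) := by
        gcongr
    _ = _ := by ring

/-- The conclusion of `Sketch.stub_transfer` ("SmoothSection"), universally closed over its parameters:
for all `k ≥ 3`, `α, η, ν > 0` there are `A > 0` and, infinitely often, `(g, G)` with `g` `ν`-valid on
`G`, `(k m)·#Gᶜ ≤ A·#Inst`, and total `η n`-jump mass `≤ A·#Inst·2n`. -/
def StubTransferWithoutHsolv : Prop :=
  ∀ k : ℕ, 3 ≤ k → ∀ α η ν : ℝ, 0 < α → 0 < η → 0 < ν →
    ∃ A : ℝ, 0 < A ∧ ∃ᶠ n : ℕ in Filter.atTop, ∀ m : ℕ, m = ⌊α * n⌋₊ →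
      ∃ g : (Fin m → Fin k → Fin n × Bool) → (Fin n → Bool),
      ∃ G : Finset (Fin m → Fin k → Fin n × Bool),
        (∀ Φ ∈ G, (((Finset.univ : Finset (Fin m)).filter fun i =>
            ∀ j, g Φ (Φ i j).1 ≠ (Φ i j).2).card : ℝ) ≤ ν * m) ∧
        ((k * m : ℕ) : ℝ) * (Gᶜ.card : ℝ) ≤ A * Fintype.card (Fin m → Fin k → Fin n × Bool) ∧
        (∑ a : Fin m, ∑ b : Fin k,
            (((Finset.univ : Finset ((Fin m → Fin k → Fin n × Bool) × (Fin n × Bool))).filter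
              fun p => η * n < hammingDist (g p.1)
                (g (Function.update p.1 a (Function.update (p.1 a) b p.2)))).card : ℝ))
          ≤ A * (Fintype.card (Fin m → Fin k → Fin n × Bool) * (2 * n))

/-- **Target: `stub_transfer` is false without `hsolv`.** At `k = 3`, `α = 32`, `η = 1`, `ν = 1/128`,
conditions (i) ∧ (ii) of SmoothSection are unsatisfiable for large `n` (every `A`, `g`, `G`): by
`card_instValid_le` and `eventually_firstMoment_lt` (`c = 1`) fewer than half of the instances can be in
`G`, so (ii) forces `3 m < 2 A`, absurd since `m = ⌊32 n⌋₊ → ∞`.  So `hsolv` is load-bearing in stub 7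
too: SmoothSection is not a free-standing property of random 3-SAT uniformly in the density (the jump
condition (iii) is not even used). -/
theorem stub_transfer_false_without_hsolv : ¬ StubTransferWithoutHsolv := by
  classical
  intro h
  obtain ⟨A, hA, hfreq⟩ := h 3 (by norm_num) 32 1 (1 / 128) (by norm_num) one_pos (by norm_num)
  have hrate : Real.log 2 + 1 < 32 * ((1 - 1 / 128) * (1 / 2) ^ 3 - Real.binEntropy (1 / 128)) := by
    have h2 := Real.log_two_lt_d9
    have hH := binEntropy_inv128_le
    nlinarith
  have hfm := eventually_firstMoment_lt (k := 3) (show (0 : ℝ) < 32 by norm_num)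
    (show (0 : ℝ) ≤ 1 / 128 by norm_num) (show (1 / 128 : ℝ) ≤ 2⁻¹ by norm_num) one_pos hrate
  obtain ⟨n, hn, hlt, hbig, hn1⟩ := (hfreq.and_eventually (hfm.and
    ((eventually_floor_ge (show (0 : ℝ) < 32 by norm_num) (⌈A⌉₊ + 1)).and
      (Filter.eventually_ge_atTop 1)))).exists
  obtain ⟨g, G, hval, hdens, -⟩ := hn _ rfl
  have hI : (0 : ℝ) < Fintype.card (Fin ⌊(32 : ℝ) * n⌋₊ → Fin 3 → Fin n × Bool) := by
    haveI : Nonempty (Fin n × Bool) := ⟨(⟨0, hn1⟩, false)⟩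
    exact_mod_cast Fintype.card_pos
  have hGsub : G ⊆ Finset.univ.filter fun Φ : Fin ⌊(32 : ℝ) * n⌋₊ → Fin 3 → Fin n × Bool =>
      (violCount (g Φ) Φ : ℝ) ≤ 1 / 128 * ⌊(32 : ℝ) * n⌋₊ := by
    intro Φ hΦ
    simp only [Finset.mem_filter, Finset.mem_univ, true_and]
    exact hval Φ hΦ
  have hsmall := card_instValid_le (k := 3) (m := ⌊(32 : ℝ) * n⌋₊) (n := n)
    (show (0 : ℝ) ≤ 1 / 128 by norm_num) (show (1 / 128 : ℝ) ≤ 2⁻¹ by norm_num) g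
  have hexp : Real.exp (-(1 * (n : ℝ))) ≤ 1 / 2 := by
    have hn' : (1 : ℝ) ≤ n := by exact_mod_cast hn1
    have h1 : Real.exp (-(1 * (n : ℝ))) ≤ Real.exp (-1) := Real.exp_le_exp.2 (by linarith)
    have h2 : Real.exp (-1) ≤ 1 / 2 := by
      have := Real.exp_one_gt_d9
      rw [Real.exp_neg, inv_le_comm₀ (Real.exp_pos 1) (by norm_num)]
      linarith
    exact h1.trans h2
  have hGcard : (G.card : ℝ) ≤ 1 / 2 * Fintype.card (Fin ⌊(32 : ℝ) * n⌋₊ → Fin 3 → Fin n × Bool) := by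
    calc (G.card : ℝ) ≤ ((Finset.univ.filter fun Φ : Fin ⌊(32 : ℝ) * n⌋₊ → Fin 3 → Fin n × Bool =>
          (violCount (g Φ) Φ : ℝ) ≤ 1 / 128 * ⌊(32 : ℝ) * n⌋₊).card : ℝ) := by
          exact_mod_cast Finset.card_le_card hGsub
      _ ≤ _ := hsmall
      _ ≤ Real.exp (-(1 * (n : ℝ))) * Fintype.card (Fin ⌊(32 : ℝ) * n⌋₊ → Fin 3 → Fin n × Bool) :=
          mul_le_mul_of_nonneg_right hlt.le hI.le
      _ ≤ 1 / 2 * Fintype.card (Fin ⌊(32 : ℝ) * n⌋₊ → Fin 3 → Fin n × Bool) :=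
          mul_le_mul_of_nonneg_right hexp hI.le
  have hGc : (1 / 2 : ℝ) * Fintype.card (Fin ⌊(32 : ℝ) * n⌋₊ → Fin 3 → Fin n × Bool) ≤ (Gᶜ.card : ℝ) := by
    have h1 : ((Gᶜ.card : ℕ) : ℝ) = Fintype.card (Fin ⌊(32 : ℝ) * n⌋₊ → Fin 3 → Fin n × Bool) - G.card := by
      rw [Finset.card_compl, Nat.cast_sub (Finset.card_le_univ G)]
    rw [h1]
    linarith
  have hkm : ((3 * ⌊(32 : ℝ) * n⌋₊ : ℕ) : ℝ) *
      (1 / 2 * Fintype.card (Fin ⌊(32 : ℝ) * n⌋₊ → Fin 3 → Fin n × Bool)) ≤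
      A * Fintype.card (Fin ⌊(32 : ℝ) * n⌋₊ → Fin 3 → Fin n × Bool) :=
    le_trans (mul_le_mul_of_nonneg_left hGc (Nat.cast_nonneg _)) hdens
  have hkm' : ((3 * ⌊(32 : ℝ) * n⌋₊ : ℕ) : ℝ) * (1 / 2) ≤ A := by
    rw [← mul_assoc] at hkm
    exact le_of_mul_le_mul_right hkm hI
  have hmbig : (⌈A⌉₊ : ℝ) + 1 ≤ (⌊(32 : ℝ) * n⌋₊ : ℝ) := by exact_mod_cast hbig
  have hAceil : A ≤ ⌈A⌉₊ := Nat.le_ceil A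
  push_cast at hkm'
  nlinarith

end Targets

/-! ## The efficiency hypothesis is load-bearing (modulo the route's two printed theorems) -/

section PolyTime

open Literature.Computability.Complexity

/-- Success of an output word `y` on an `ℕ`-indexed clause list: every clause has a literal `(v, b)`
with `y.getD v false = b` (the crux's reading of the output of `f`). -/
def GoodFor (L : CNF ℕ) (y : List Bool) : Prop := ∀ C ∈ L, ∃ l ∈ C, y.getD l.1 false = l.2

open scoped Classical in
/-- The complexity-free solver `f*`: on a codeword `x = encode L` it outputs SOME word good for `L`
whenever one exists (no complexity bound: `Classical.choose` over the decoded instance). -/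
noncomputable def fStar (x : List Bool) : List Bool :=
  if h : ∃ p : CNF ℕ × List Bool, encodingCNF.encode p.1 = x ∧ GoodFor p.1 p.2 then
    (Classical.choose h).2 else []

/-- `f*` succeeds on every instance admitting a good word (injectivity of `encodingCNF`). -/
theorem fStar_good (L : CNF ℕ) (y : List Bool) (hy : GoodFor L y) :
    GoodFor L (fStar (encodingCNF.encode L)) := by
  classical
  have h : ∃ p : CNF ℕ × List Bool, encodingCNF.encode p.1 = encodingCNF.encode L ∧ GoodFor p.1 p.2 :=
    ⟨(L, y), rfl, hy⟩
  unfold fStar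
  rw [dif_pos h]
  obtain ⟨h1, h2⟩ := Classical.choose_spec h
  rwa [encodingCNF.encode_injective h1] at h2

/-- `f*` solves (in the crux's sense) every satisfiable typed instance `Φ`. -/
theorem fStar_solves {k m n : ℕ} (Φ : Fin m → Fin k → Fin n × Bool)
    (hΦ : ∃ σ : Fin n → Bool, ∀ i, ∃ j, σ (Φ i j).1 = (Φ i j).2) :
    ∀ i, ∃ j, (fStar (encodingCNF.encode (List.ofFn fun a =>
      List.ofFn fun b => (((Φ a b).1 : ℕ), (Φ a b).2)))).getD (Φ i j).1 false = (Φ i j).2 := by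
  obtain ⟨σ, hσ⟩ := hΦ
  set L : CNF ℕ := List.ofFn fun a => List.ofFn fun b => (((Φ a b).1 : ℕ), (Φ a b).2) with hL
  have hyget : ∀ v : Fin n, (List.ofFn σ).getD v false = σ v := by
    intro v
    simp [List.getD_eq_getElem?_getD]
  have hgood : GoodFor L (List.ofFn σ) := by
    intro C hC
    rw [hL, List.mem_ofFn] at hC
    obtain ⟨a, rfl⟩ := hC
    obtain ⟨b, hb⟩ := hσ a
    refine ⟨(((Φ a b).1 : ℕ), (Φ a b).2), List.mem_ofFn.2 ⟨b, rfl⟩, ?_⟩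
    change (List.ofFn σ).getD ((Φ a b).1 : ℕ) false = (Φ a b).2
    rw [hyget]
    exact hb
  have hstar := fStar_good L _ hgood
  intro i
  have hCi : (List.ofFn fun b => (((Φ i b).1 : ℕ), (Φ i b).2)) ∈ L := by
    rw [hL, List.mem_ofFn]
    exact ⟨i, rfl⟩
  obtain ⟨l, hl, hval⟩ := hstar _ hCi
  rw [List.mem_ofFn] at hl
  obtain ⟨j, rfl⟩ := hl
  exact ⟨j, hval⟩

/-- The crux's hypothesis with `IsPolyTime f` deleted: SOME function solves with non-vanishing
probability. -/
def SolvableAny (k : ℕ) (α : ℝ) : Prop :=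
  ∃ f : List Bool → List Bool, ∃ ε : ℝ, 0 < ε ∧
    ∃ᶠ n : ℕ in Filter.atTop, ∀ m : ℕ, m = ⌊α * n⌋₊ → ε ≤
      ((Finset.univ.filter fun Φ : Fin m → Fin k → Fin n × Bool => ∀ i, ∃ j,
        (f (Literature.Computability.Complexity.encodingCNF.encode (List.ofFn fun a =>
          List.ofFn fun b => (((Φ a b).1 : ℕ), (Φ a b).2)))).getD (Φ i j).1 false =
            (Φ i j).2).card : ℝ) / Fintype.card (Fin m → Fin k → Fin n × Bool)

/-- The crux with the efficiency conjunct `IsPolyTime f` deleted. -/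
def SolvableImpliesStableSectionWithoutPolyTime : Prop :=
  ∀ k : ℕ, 3 ≤ k → ∀ α η ν : ℝ, 0 < α → 0 < η → 0 < ν → SolvableAny k α → Concl k α η ν

/-- Uniformly positive satisfiability makes `f*` a (complexity-free) solver with non-vanishing
success: `SolvableAny` holds wherever `Pr[Φ satisfiable] ≥ ε` eventually. -/
theorem solvableAny_of_satProb {k : ℕ} {α ε : ℝ} (hε : 0 < ε)
    (hsat : ∀ᶠ n : ℕ in Filter.atTop, ∀ m : ℕ, m = ⌊α * n⌋₊ → ε ≤
      ((Finset.univ.filter fun Φ : Fin m → Fin k → Fin n × Bool =>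
        ∃ σ : Fin n → Bool, ∀ i, ∃ j, σ (Φ i j).1 = (Φ i j).2).card : ℝ) /
        Fintype.card (Fin m → Fin k → Fin n × Bool)) :
    SolvableAny k α := by
  refine ⟨fStar, ε, hε, Filter.Eventually.frequently (hsat.mono fun n hn m hm => ?_)⟩
  refine (hn m hm).trans (div_le_div_of_nonneg_right ?_ (Nat.cast_nonneg _))
  exact_mod_cast Finset.card_le_card fun Φ hΦ => by
    simp only [Finset.mem_filter, Finset.mem_univ, true_and] at hΦ ⊢
    exact fStar_solves Φ hΦ

/-- **`IsPolyTime` is load-bearing** (crux NOTES B1 as a theorem, at crux level): the route's own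
cruxes `NoStableSection` (item 2462, Bresler–Huang 2021 Thm 2.6 read for all maps) and
`PositiveSatProbability` (item 2464, Achlioptas–Peres 2004 Thm 2) REFUTE the crux with the
efficiency conjunct deleted — inside the OGP window `f*` meets the weakened hypothesis while every
section fails.  Hence any proof of the crux must use the polynomial-time machine of `f` white-box:
constructions of `g` from the input/output behaviour and success probability of `f` alone are dead. -/
theorem solvableImpliesStableSection_false_without_polyTime_of
    (hNo : NoStableSection) (hPos : PositiveSatProbability) :
    ¬ SolvableImpliesStableSectionWithoutPolyTime := by
  intro hT
  obtain ⟨k₀, hk₀⟩ := hNo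
  obtain ⟨k₁, hk₁⟩ := hPos
  obtain ⟨k, hk0, hk1, hk3⟩ : ∃ k : ℕ, k₀ ≤ k ∧ k₁ ≤ k ∧ 3 ≤ k :=
    ⟨max (max k₀ k₁) 3, le_trans (le_max_left _ _) (le_max_left _ _),
      le_trans (le_max_right _ _) (le_max_left _ _), le_max_right _ _⟩
  obtain ⟨η, hη, ν, hν, c, hc, hev⟩ := hk₀ k hk0
  obtain ⟨ε, hε, hsat⟩ := hk₁ k hk1
  -- positivity of the window density `α = 5·2^k·log k/k` (uses `k ≥ 3`)
  have hk1' : (1 : ℝ) < k := by exact_mod_cast (by omega : 1 < k)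
  have hkpos : (0 : ℝ) < k := by linarith
  have hlog : 0 < Real.log k := Real.log_pos hk1'
  have hα : (0 : ℝ) < 5 * 2 ^ k * Real.log k / k :=
    div_pos (mul_pos (mul_pos (by norm_num) (by positivity)) hlog) hkpos
  -- the weakened crux, fed with `f*` and the rate `c/2`
  have key := hT k hk3 (5 * 2 ^ k * Real.log k / k) η ν hα hη hν (solvableAny_of_satProb hε hsat)
    (c / 2) (half_pos hc)
  refine Filter.frequently_false (Filter.atTop : Filter ℕ)
    ((key.and_eventually (hev.and (Filter.eventually_ge_atTop 1))).mono ?_)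
  rintro n ⟨h₁, h₂, hn1⟩
  obtain ⟨g, hg⟩ := h₁ _ rfl
  have hg' := h₂ _ rfl g
  have hcard := card_paths_pos k ⌊5 * 2 ^ k * Real.log k / k * (n : ℝ)⌋₊ hn1
  have hle : Real.exp (-(c / 2 * n)) ≤ Real.exp (-(c * n)) :=
    le_of_mul_le_mul_right (hg.trans hg') hcard
  have hn' : (1 : ℝ) ≤ n := by exact_mod_cast hn1
  have := Real.exp_le_exp.1 hle
  nlinarith

end PolyTime


/-! ## Generation 2 (refuter-cdisprove-stmt-PneNP-2463-g2-0, 2026-08-16): `0 < η` is load-bearing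

The theorems of this section are thin wrappers, in the `Solvable`/`Concl`/`PathEvent` vocabulary of this
file, around the def-free tree files `Theorems/SolvableImpliesStableSection/Negative/FalseAtEtaZero.lean`
(p128036, ACCEPTED), `…/Negative/EndpointsFar.lean` (p128366, ACCEPTED) and
`…/Negative/FalseAtEtaZeroSharp.lean` (p128592, ACCEPTED: the SHARP range `ν < 2^{-k}` for frozen
sections by exponential tilting). -/

section EtaZero

open Summit.PneNP.PneNP.Cruxes.SolvableImpliesStableSection

/-- **`Concl` is false for frozen sections, at EVERY density** (`Negative.concl_false_of_eta_nonpos`):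
`k ≥ 1`, `α > 0`, `η ≤ 0`, `0 ≤ ν ≤ 1/2`, `h₂(ν) < (1-ν)2^{-k}` ⇒ `¬ Concl k α η ν`.  With step budget
`η n ≤ 0` the section is constant along sweep 0, so `g (Ψ 0)` (a function of `Ψ 0` alone) must be
`ν`-valid for the INDEPENDENT array `Ψ 1`; a fixed assignment is `ν`-valid for at most
`(⌊νm⌋₊+1)e^{m h₂(ν)}e^{-2^{-k}(1-ν)m}·#Inst` arrays.  No `2^n`, no density condition — contrast
`concl_false_of_rate` (unsatisfiable phase only). -/
theorem concl_false_of_eta_nonpos {k : ℕ} (hk : 1 ≤ k) {α η ν : ℝ} (hα : 0 < α) (hη : η ≤ 0)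
    (hν0 : 0 ≤ ν) (hν2 : ν ≤ 2⁻¹) (hR : Real.binEntropy ν < (1 - ν) * (1 / 2 : ℝ) ^ k) :
    ¬ Concl k α η ν :=
  Negative.concl_false_of_eta_nonpos hk hα hη hν0 hν2 hR

/-- **Sharp in `ν`: frozen sections fail for EVERY `ν < 2^{-k}`** (`Negative.concl_false_of_eta_nonpos_of_lt`,
exponential tilting `#{Φ : violCount σ Φ ≤ J}·t^J ≤ (1 - 2^{-k}(1-t))^m·#Inst`, Chernoff rate
`2^{-k} - ν - ν log(2^{-k}/ν) > 0`): `k ≥ 1`, `α > 0`, `η ≤ 0`, `0 ≤ ν < 2^{-k}` ⇒ `¬ Concl k α η ν`.  With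
the lead's constant section (`ν > 2^{-k}`, zero movement) the zero-movement regime is completely charted:
at `η = 0` the conclusion holds iff `ν > 2^{-k}` (boundary aside), at every density, solvable or not. -/
theorem concl_false_of_eta_nonpos_of_lt {k : ℕ} (hk : 1 ≤ k) {α η ν : ℝ} (hα : 0 < α) (hη : η ≤ 0)
    (hν0 : 0 ≤ ν) (hνp : ν < (1 / 2 : ℝ) ^ k) : ¬ Concl k α η ν :=
  Negative.concl_false_of_eta_nonpos_of_lt hk hα hη hν0 hνp

/-- **Witness at every density:** `¬ Concl k α 0 8^{-k}` for every `k ≥ 1`, `α > 0`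
(`Negative.concl_false_at_eta_zero`; `h₂(8^{-k}) < (1 - 8^{-k})2^{-k}`). -/
theorem concl_false_at_eta_zero {k : ℕ} (hk : 1 ≤ k) {α : ℝ} (hα : 0 < α) :
    ¬ Concl k α 0 ((1 / 8 : ℝ) ^ k) :=
  Negative.concl_false_at_eta_zero hk hα

/-- **The `η`-range of the crux, from both ends.**  At `η = 0` the conclusion fails at every density
(this generation); for `η ≥ 1` it follows from solvability alone, `IsPolyTime` not needed (the lead's
`Sketch.solvableImpliesStableSection_of_eta_ge_one`, `…EtaGeOne.lean`).  So the content of the crux is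
exactly the per-step budget `η n` with `0 < η < 1`: the section promised by the crux exists unstably and
cannot be frozen; everything is about HOW SLOWLY it may move. -/
theorem concl_eta_range {k : ℕ} (hk : 1 ≤ k) {α : ℝ} (hα : 0 < α) :
    (¬ Concl k α 0 ((1 / 8 : ℝ) ^ k)) ∧
      ∀ η ν : ℝ, 1 ≤ η → 0 < ν → SolvableAny k α → Concl k α η ν :=
  ⟨concl_false_at_eta_zero hk hα, fun η ν hη hν hs =>
    Sketch.solvableImpliesStableSection_of_eta_ge_one k hk α η ν hα hη hν hs⟩

/-- The crux with its hypothesis `0 < η` weakened to `0 ≤ η`. -/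
def SolvableImpliesStableSectionWithEtaZero : Prop :=
  ∀ k : ℕ, 3 ≤ k → ∀ α η ν : ℝ, 0 < α → 0 ≤ η → 0 < ν → Solvable k α → Concl k α η ν

/-- **Solvability anywhere** — the `H` of the negative-lemma-modulo pattern: some polynomial-time `f`
solves `F_k(n, ⌊αn⌋)` with non-vanishing probability at SOME `k ≥ 3`, `α > 0`.  True in print (Unit
Clause at `k = 3`, `α < 8/3`, Chao–Franco 1990; the copy rule at `α ≤ 1/(2e²)`, in the tree as a map in
`…SearchHardWindowAffineRung*.lean`), but no solver is yet constructed in the tree's `IsPolyTime`/`FP`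
model (a register-machine implementation of bipartite matching / unit propagation, cf. the bricks used
for `EvalRelationInP`), so it stays a hypothesis. -/
def SolvableSomewhere : Prop :=
  ∃ k : ℕ, 3 ≤ k ∧ ∃ α : ℝ, 0 < α ∧ Solvable k α

/-- **`0 < η` is load-bearing (modulo `SolvableSomewhere`):** the crux with `0 ≤ η` in place of `0 < η`
is false as soon as its hypothesis holds anywhere (`Negative.solvableImpliesStableSection_false_with_eta_zero_of`). -/
theorem solvableImpliesStableSection_false_with_eta_zero_of (H : SolvableSomewhere) :
    ¬ SolvableImpliesStableSectionWithEtaZero :=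
  Negative.solvableImpliesStableSection_false_with_eta_zero_of H

/-- Read positively: IF the crux holds, then wherever `Solvable k α` holds (`k ≥ 3`) the sections it
promises are necessarily MOVING ones — `Concl k α η ν` for every `η, ν > 0` while `¬ Concl k α 0 8^{-k}`. -/
theorem crux_sections_must_move (hT : SolvableImpliesStableSection) {k : ℕ} (hk : 3 ≤ k) {α : ℝ}
    (hα : 0 < α) (hs : Solvable k α) :
    (∀ η ν : ℝ, 0 < η → 0 < ν → Concl k α η ν) ∧ ¬ Concl k α 0 ((1 / 8 : ℝ) ^ k) :=
  ⟨fun η ν hη hν => hT k hk α η ν hα hη hν hs, concl_false_at_eta_zero (by omega) hα⟩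

/-- **Valid sections travel a linear distance per sweep** (`PathEvent` form of
`Negative.card_validClose_lt`): if `h₂(β) + c < α((1-ν)2^{-k} - h₂(ν))` then eventually, for every
step budget `η` and every `g`, the paths of the path event on which moreover
`d_H(g(Ψ 0), g(Ψ 1)) ≤ βn` are fewer than `e^{-cn}·#paths`.  On the path event the section therefore
moves a total distance `> βn` between the independent endpoints of sweep 0 (and, by symmetry of the
argument, of every sweep), spending its per-step budget `ηn` on at least `β/η` steps. -/
theorem pathEvent_endpoints_far {k : ℕ} (hk : 1 ≤ k) {α ν β c : ℝ} (hα : 0 < α) (hν0 : 0 ≤ ν)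
    (hν2 : ν ≤ 2⁻¹) (hβ0 : 0 ≤ β) (hβ2 : β ≤ 2⁻¹)
    (hrate : Real.binEntropy β + c < α * ((1 - ν) * (1 / 2 : ℝ) ^ k - Real.binEntropy ν)) :
    ∀ᶠ n : ℕ in Filter.atTop, ∀ (η : ℝ) (g : (Fin ⌊α * n⌋₊ → Fin k → Fin n × Bool) → (Fin n → Bool)),
      ((Finset.univ.filter fun Ψ => PathEvent k ⌊α * n⌋₊ n η ν g Ψ ∧
          (hammingDist (g (Ψ 0)) (g (Ψ ⟨1, Nat.lt_succ_of_le hk⟩)) : ℝ) ≤ β * n).card : ℝ) <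
        Real.exp (-(c * n)) * Fintype.card (Fin (k + 1) → Fin ⌊α * n⌋₊ → Fin k → Fin n × Bool) := by
  filter_upwards [Negative.card_validClose_lt hk hα hν0 hν2 hβ0 hβ2 hrate] with n hn η g
  refine lt_of_le_of_lt ?_ (hn g)
  exact_mod_cast Finset.card_le_card fun Ψ hΨ => by
    simp only [Finset.mem_filter, Finset.mem_univ, true_and] at hΨ ⊢
    exact ⟨hΨ.1.1, hΨ.2⟩

/-- **Separation at every density** (`PathEvent` form of `Negative.exists_separation`): for every
`k ≥ 1`, `α > 0` there are `ν, β, c > 0` such that eventually, for every `η` and `g`, the paths of the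
path event with `d_H(g(Ψ 0), g(Ψ 1)) ≤ βn` are fewer than `e^{-cn}·#paths`. -/
theorem exists_separation_pathEvent {k : ℕ} (hk : 1 ≤ k) {α : ℝ} (hα : 0 < α) :
    ∃ ν : ℝ, 0 < ν ∧ ∃ β : ℝ, 0 < β ∧ ∃ c : ℝ, 0 < c ∧
    ∀ᶠ n : ℕ in Filter.atTop, ∀ (η : ℝ) (g : (Fin ⌊α * n⌋₊ → Fin k → Fin n × Bool) → (Fin n → Bool)),
      ((Finset.univ.filter fun Ψ => PathEvent k ⌊α * n⌋₊ n η ν g Ψ ∧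
          (hammingDist (g (Ψ 0)) (g (Ψ ⟨1, Nat.lt_succ_of_le hk⟩)) : ℝ) ≤ β * n).card : ℝ) <
        Real.exp (-(c * n)) * Fintype.card (Fin (k + 1) → Fin ⌊α * n⌋₊ → Fin k → Fin n × Bool) := by
  obtain ⟨ν, hν, β, hβ, c, hc, hev⟩ := Negative.exists_separation hk hα
  refine ⟨ν, hν, β, hβ, c, hc, ?_⟩
  filter_upwards [hev] with n hn η g
  refine lt_of_le_of_lt ?_ (hn g)
  exact_mod_cast Finset.card_le_card fun Ψ hΨ => by
    simp only [Finset.mem_filter, Finset.mem_univ, true_and] at hΨ ⊢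
    exact ⟨hΨ.1.1, hΨ.2⟩

end EtaZero

end Summit.PneNP.PneNP.Cruxes.SolvableImpliesStableSection.Disproof
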